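import Summits.Schanuel.Schanuel.Theorems.RootDecomp1ELWTransport04

/-!
# RootDecomp1ELWTransport — lens 2, generation 39 «LW-PAIR NORM TRANSPORT CELL» (lane E-R18 (a)): S ITSELF on the class `InLWClass` (E-doubled moment curves over a dyadic 2-fold-hyper-Liouville T), engine `algebraicIndependent_lwPt` mod `hLW : LWMeasure` — continuation (RootDecomp1ELWTransport05): §3 THE TRANSPORT THEOREM `algebraicIndependent_lwPt` (kernel, `maxHeartbeats 1600000 in` carried)

(lens-2 g39 `LWTransport.lean` [HOME/decomp-schanuel-lens-2/g39/ sha256 cff5d88d…e8f0, 2208 l; NODE L1907 / REQUEST L1908; critic VERDICT L1909 (CLEARED, E-R18 (a) cell credit, port GO)]; port by census-1 gen 17 as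
`RootDecomp1ELWTransport01`–`09` — see the PORT NOTE of part 01; `--supports stmt-Schanuel-31409`; rung 0.)
-/

noncomputable section

open Complex Polynomial
open Literature.NumberTheory.Transcendental (zlen zlen_nonneg zlen_add_le zlen_monomial_le zlen_sum_le
  zlen_mul_le zlen_pow_le)

namespace Summit.Schanuel.Schanuel.Theorems.RootDecomp1ELWTransport

open Summit.Schanuel.Schanuel.Theorems.RootDecomp1KHyper (SB SFset sb_of_algebraicIndependent LWMeasure
  exists_ball_eval_ne_zero exists_int_mul_eq_map mvaeval_int_map)
open Summit.Schanuel.Schanuel.Theorems.RootDecomp1KHyper.HyperCell (Ewt exC collPoly collPoly_ne_zero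
  exC_inj)
open NormDescent (P2)

variable {k : ℕ}

/-- `x ≤ Real.exp x` (for `(x : ℝ)`). -/
private theorem le_exp_self (x : ℝ) : x ≤ Real.exp x := by linarith [Real.add_one_le_exp x]

/-- `x ^ n ≤ Real.exp (n * x)` (for `{x : ℝ} (hx : 0 ≤ x) (n : ℕ)`). -/
private theorem pow_le_exp_mul {x : ℝ} (hx : 0 ≤ x) (n : ℕ) : x ^ n ≤ Real.exp (n * x) := by
  rw [Real.exp_nat_mul]; exact pow_le_pow_left₀ hx (le_exp_self x) n

/-- `s i ≤ P.totalDegree`. -/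
private theorem apply_le_totalDegree {σ : Type*} {P : MvPolynomial σ ℤ} {s : σ →₀ ℕ}
    (hs : s ∈ P.support) (i : σ) : s i ≤ P.totalDegree := by
  refine le_trans ?_ (MvPolynomial.le_totalDegree hs)
  by_cases hi : i ∈ s.support
  · exact Finset.single_le_sum (f := fun j => s j) (fun _ _ => Nat.zero_le _) hi
  · simp [Finsupp.notMem_support_iff.mp hi]

/-- `|((Q.coeff m : ℤ) : ℝ)| ≤ zlen Q` (for `{σ : Type*} (Q : MvPolynomial σ ℤ) (m : σ →₀ ℕ)`). -/
private theorem abs_coeff_le_zlen {σ : Type*} (Q : MvPolynomial σ ℤ) (m : σ →₀ ℕ) :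
    |((Q.coeff m : ℤ) : ℝ)| ≤ zlen Q := by
  by_cases hm : m ∈ Q.support
  · rw [zlen]
    exact Finset.single_le_sum (f := fun s => |((Q.coeff s : ℤ) : ℝ)|) (fun _ _ => abs_nonneg _) hm
  · rw [MvPolynomial.notMem_support_iff.mp hm, Int.cast_zero, abs_zero]; exact zlen_nonneg Q

/-- `1 ≤ zlen f` (for `{σ : Type*} {f : MvPolynomial σ ℤ} (hf : f ≠ 0)`). -/
private theorem one_le_zlen' {σ : Type*} {f : MvPolynomial σ ℤ} (hf : f ≠ 0) : 1 ≤ zlen f := by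
  obtain ⟨m, hm⟩ := MvPolynomial.ne_zero_iff.mp hf
  exact le_trans (by exact_mod_cast Int.one_le_abs hm) (abs_coeff_le_zlen f m)

set_option maxHeartbeats 1600000 in
/-- **Theorem (LW-pair norm transport; every `k`, mod the Literature fact `hLW`, which is PROVED in the
tree as `Literature.NumberTheory.Transcendental.Ably1994_lindemannWeierstrass_measure_holds`).**
For `β` algebraic irrational and `T > 0` dyadic 2-fold hyper-Liouville, the `2k + 1` numbers
`T, e^{T}, …, e^{T^k}, e^{βT}, …, e^{βT^k}` are algebraically independent over `ℚ`. -/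
theorem algebraicIndependent_lwPt (hLW : LWMeasure) {β : ℂ} (hβalg : IsAlgebraic ℚ β)
    (hβirr : ∀ r : ℚ, (r : ℂ) ≠ β) {T : ℝ} (hT : DyadicHyper₂ T) (hT0 : 0 < T) (k : ℕ) :
    AlgebraicIndependent ℚ (lwPt k β (T : ℂ)) := by
  by_contra hdep
  -- an integer relation `P(lwPt T) = 0`, `P ≠ 0`
  obtain ⟨P, hP0, hPu⟩ : ∃ P : MvPolynomial (Fin (k + k + 1)) ℤ, P ≠ 0 ∧
      MvPolynomial.aeval (lwPt k β (T : ℂ)) P = 0 := by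
    have h1 : ¬ Function.Injective
        (MvPolynomial.aeval (lwPt k β (T : ℂ)) : MvPolynomial (Fin (k + k + 1)) ℚ →ₐ[ℚ] ℂ) := hdep
    rw [injective_iff_map_eq_zero] at h1
    push Not at h1
    obtain ⟨g, hg0, hgne⟩ := h1
    obtain ⟨N, G, hN, hG⟩ := exists_int_mul_eq_map g
    refine ⟨G, ?_, ?_⟩
    · intro hG0
      rw [hG0, map_zero] at hG
      have hC : (MvPolynomial.C (N : ℚ) : MvPolynomial (Fin (k + k + 1)) ℚ) ≠ 0 :=
        MvPolynomial.C_eq_zero.not.mpr (by exact_mod_cast hN)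
      exact (mul_ne_zero hC hgne) hG.symm
    · rw [← mvaeval_int_map _ G, hG, map_mul, MvPolynomial.aeval_C, hg0, mul_zero]
  have hFT : FL P β T = 0 := by rw [FL_eq]; exact hPu
  -- Ably's constants at the FIXED pair `y = (1, β)`
  set y : Fin 2 → ℂ := ![1, β] with hy
  have hyalg : ∀ i, IsAlgebraic ℚ (y i) := by
    intro i
    rcases Fin.exists_fin_two.mp ⟨i, rfl⟩ with h | h
    · rw [h]; simp only [hy, Matrix.cons_val_zero]; exact isAlgebraic_one
    · rw [h]; simp only [hy, Matrix.cons_val_one, Matrix.cons_val_zero]; exact hβalg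
  have hyli : LinearIndependent ℚ y := by
    rw [hy, LinearIndependent.pair_iff]
    intro s t hst
    rw [Algebra.smul_def, Algebra.smul_def, eq_ratCast, eq_ratCast, mul_one] at hst
    by_cases ht : t = 0
    · refine ⟨?_, ht⟩
      have : (s : ℂ) = 0 := by simpa [ht] using hst
      exact_mod_cast this
    · exfalso
      refine hβirr (-s / t) ?_
      have ht' : (t : ℂ) ≠ 0 := by exact_mod_cast ht
      rw [Rat.cast_div, Rat.cast_neg, div_eq_iff ht']
      linear_combination -hst
  obtain ⟨C, c₂, hC, hc₂, hmeas⟩ := hLW 2 y hyalg hyli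
  -- the data of the relation
  set d : ℕ := P.totalDegree with hd
  obtain ⟨t, ht⟩ : ∃ t, t ∈ P.support := by
    obtain ⟨t, ht⟩ := MvPolynomial.ne_zero_iff.mp hP0
    exact ⟨t, MvPolynomial.mem_support_iff.mpr ht⟩
  have hfib0 : fib P t ≠ 0 := fib_ne_zero P ht
  obtain ⟨δ₀, hδ₀, hball⟩ := exists_ball_eval_ne_zero ((fib P t).map (Int.castRingHom ℂ))
    ((Polynomial.map_ne_zero_iff (RingHom.injective_int _)).mpr hfib0) T
  obtain ⟨δ₂, hδ₂, hball₂⟩ := exists_ball_eval_ne_zero (collPoly k d) (collPoly_ne_zero k d) T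
  obtain ⟨Kl, δ₁, hKl0, hδ₁, hlipF⟩ := exists_lipschitz_FL P β T
  -- constants (depend on `P, T, β, k, C, c₂` only)
  set L : ℝ := zlen P with hL
  have hL1 : 1 ≤ L := one_le_zlen' hP0
  have hL0 : 0 ≤ L := by linarith
  have hd0 : (0 : ℝ) ≤ d := Nat.cast_nonneg d
  set cT : ℝ := T + 2 with hcT
  have hcT0 : 0 ≤ cT := by rw [hcT]; linarith
  set cN : ℝ := (d : ℝ) * cT ^ k with hcN
  have hcN0 : 0 ≤ cN := by positivity
  set cA : ℝ := (d : ℝ) * cT + L with hcA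
  have hcA0 : 0 ≤ cA := by positivity
  set cR : ℝ := 1 + ‖β‖ with hcR
  have hcR1 : 1 ≤ cR := by rw [hcR]; linarith [norm_nonneg β]
  have hcR0 : 0 ≤ cR := by linarith
  set a₁ : ℝ := 2 * c₂ * cN ^ 2 + (cA + 1 + C * cN ^ 2 * (cN + 1)) with ha₁
  have ha₁0 : 0 ≤ a₁ := by positivity
  set a₂ : ℝ := (d : ℝ) + Kl + cA + 3 * cR * cN with ha₂
  have ha₂0 : 0 ≤ a₂ := by positivity
  set a : ℝ := 2 * a₁ + a₂ with ha
  have ha0 : 0 ≤ a := by positivity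
  set Cbig : ℝ := a + 1 + |Real.log δ₀| + |Real.log δ₁| + |Real.log δ₂| + |Real.log T| + 1 with hCbig
  have habs0 := abs_nonneg (Real.log δ₀)
  have habs1 := abs_nonneg (Real.log δ₁)
  have habs2 := abs_nonneg (Real.log δ₂)
  have habsT := abs_nonneg (Real.log T)
  have hCbig0 : 0 ≤ Cbig := by rw [hCbig]; linarith
  set e : ℕ := 3 * (2 * k + 1) with he
  set m : ℕ := ⌈Cbig⌉₊ + (e + 1) with hm
  -- the approximant
  obtain ⟨μ, p, hmμ, hne, hlt⟩ := hT m
  set q : ℕ := 2 ^ μ with hq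
  have hqr : (q : ℝ) = 2 ^ μ := by simp [hq]
  have hμ1 : 1 ≤ μ := le_trans (by omega) hmμ
  have hq2 : 2 ≤ q := by
    rw [hq]; calc 2 = 2 ^ 1 := by norm_num
      _ ≤ 2 ^ μ := Nat.pow_le_pow_right (by norm_num) hμ1
  have hq1 : 1 ≤ q := by omega
  have hq0 : q ≠ 0 := by omega
  have hqC : (q : ℂ) ≠ 0 := by exact_mod_cast hq0
  have hq1r : (1 : ℝ) ≤ q := by exact_mod_cast hq1
  have hq2r : (2 : ℝ) ≤ q := by exact_mod_cast hq2
  have hq0r : (0 : ℝ) ≤ q := by linarith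
  have hCm : Cbig ≤ (m : ℝ) := by
    rw [hm, Nat.cast_add]; have := Nat.le_ceil Cbig
    linarith [(Nat.cast_nonneg (e + 1) : (0 : ℝ) ≤ ((e + 1 : ℕ) : ℝ))]
  have hmq : (m : ℝ) ≤ q := by
    have h1 : m ≤ μ := hmμ
    have h2 : μ < 2 ^ μ := Nat.lt_two_pow_self
    rw [hq]; exact_mod_cast (h1.trans h2.le)
  have hCq : Cbig ≤ (q : ℝ) := hCm.trans hmq
  have haq : a + 1 ≤ (q : ℝ) := by rw [hCbig] at hCq; linarith
  -- `η = |T − p/q|`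
  set η : ℝ := |T - (p : ℝ) / q| with hη
  have hpq_eq : (p : ℝ) / 2 ^ μ = (p : ℝ) / q := by rw [hqr]
  have hη0 : 0 < η := by
    rw [hη]; exact abs_pos.mpr (sub_ne_zero.mpr (by rw [← hpq_eq]; exact hne))
  have hpow2 : (2 : ℝ) ^ (m * μ) = (q : ℝ) ^ m := by rw [hqr, ← pow_mul, mul_comm]
  have hηlt : η < Real.exp (-Real.exp ((q : ℝ) ^ m)) := by
    rw [hη, ← hpq_eq, ← hpow2]; exact hlt
  have hme : e + 1 ≤ m := by rw [hm]; omega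
  have hqm1 : (q : ℝ) ≤ (q : ℝ) ^ m := le_self_pow₀ hq1r (by omega)
  have hηC : η < Real.exp (-Cbig) := by
    refine hηlt.trans_le (Real.exp_le_exp.mpr ?_)
    have : (q : ℝ) ^ m ≤ Real.exp ((q : ℝ) ^ m) := le_exp_self _
    linarith
  have hη_of : ∀ x : ℝ, 0 < x → |Real.log x| ≤ Cbig → η < x := by
    intro x hx hlx
    refine hηC.trans_le ?_
    calc Real.exp (-Cbig) ≤ Real.exp (Real.log x) :=
          Real.exp_le_exp.mpr (by linarith [neg_abs_le (Real.log x)])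
      _ = x := Real.exp_log hx
  have hηδ₀ : η < δ₀ := hη_of δ₀ hδ₀ (by rw [hCbig]; linarith)
  have hηδ₁ : η < δ₁ := hη_of δ₁ hδ₁ (by rw [hCbig]; linarith)
  have hηδ₂ : η < δ₂ := hη_of δ₂ hδ₂ (by rw [hCbig]; linarith)
  have hηT : η < T := hη_of T hT0 (by rw [hCbig]; linarith)
  have hη1 : η ≤ 1 := by
    refine hηC.le.trans ?_
    rw [Real.exp_le_one_iff]; linarith
  -- the rational point `r = p/q`
  set r : ℝ := (p : ℝ) / q with hr
  have hrT : r ≠ T := by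
    intro h
    have h0 : η = 0 := by rw [hη, h, sub_self, abs_zero]
    exact hη0.ne' h0
  have hrT' : |r - T| = η := by rw [hη, hr, abs_sub_comm]
  have hrC : ((r : ℝ) : ℂ) = (p : ℂ) / q := by
    rw [hr, Complex.ofReal_div, Complex.ofReal_natCast, Complex.ofReal_natCast]
  have hpq : (p : ℝ) + q ≤ cT * q := by
    have hq0' : (q : ℝ) ≠ 0 := by positivity
    have h1 : (p : ℝ) = r * q := by rw [hr]; field_simp
    have h2 : r ≤ T + 1 := by
      have := abs_le.mp (hrT'.le.trans hη1 : |r - T| ≤ 1); linarith [this.2]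
    rw [h1, hcT]
    calc r * q + q ≤ (T + 1) * q + q := by gcongr
      _ = (T + 2) * q := by ring
  -- (E2) the collapsed polynomial `A ≠ 0`
  have hD : ∀ s ∈ P.support, s 0 ≤ d := fun s hs => apply_le_totalDegree hs 0
  have hDi : ∀ s ∈ P.support, ∀ i, s i ≤ d := fun s hs i => apply_le_totalDegree hs i
  have hcoll : (collPoly k d).eval ((p : ℂ) / q) ≠ 0 := by
    have h := hball₂ r hrT (by rw [hrT']; exact hηδ₂)
    rwa [hrC] at h
  have hfibv : ((fib P t).map (Int.castRingHom ℂ)).eval ((p : ℂ) / q) ≠ 0 := by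
    have h := hball r hrT (by rw [hrT']; exact hηδ₀)
    rwa [hrC] at h
  set A : P2 := Apoly P d p q with hAdef
  have hA0 : A ≠ 0 := Apoly_ne_zero P hD hDi hq0 hcoll ht hfibv
  set N : ℕ := d * (p + q) ^ k with hNdef
  have hAdeg : A.totalDegree ≤ N := totalDegree_Apoly_le P d p q
  have hAlen : zlen A ≤ ((p : ℝ) + q) ^ d * L := zlen_Apoly_le P hD
  have hA1 : 1 ≤ zlen A := NormDescent.one_le_zlen hA0
  -- (E1) + Lipschitz: `|A(u, v)| ≤ q^d · Kl · η`
  set u : ℂ := cexp (((q : ℂ) ^ k)⁻¹) with hu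
  set v : ℂ := cexp (β * ((q : ℂ) ^ k)⁻¹) with hv
  set w : Fin 2 → ℂ := ![u, v] with hw
  have hAval : MvPolynomial.aeval w A = (q : ℂ) ^ d * FL P β r := by
    rw [hw, hu, hv, hAdef, aeval_Apoly P hD hq0 β, FL_eq, hrC]
  have hAle : ‖MvPolynomial.aeval w A‖ ≤ (q : ℝ) ^ d * Kl * η := by
    rw [hAval, norm_mul, norm_pow, Complex.norm_natCast]
    have h1 : ‖FL P β r‖ ≤ Kl * η := by
      have h2 := hlipF r (by rw [hrT']; exact hηδ₁)
      rwa [hFT, sub_zero, hrT'] at h2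
    calc (q : ℝ) ^ d * ‖FL P β r‖ ≤ (q : ℝ) ^ d * (Kl * η) := by gcongr
      _ = (q : ℝ) ^ d * Kl * η := by ring
  -- the descent: `μ k` steps, `2^{μk} = q^k`
  set n : ℕ := μ * k with hn
  have h2n : 2 ^ n = q ^ k := by rw [hn, hq, pow_mul]
  have h4n : (4 : ℝ) ^ n = ((q : ℝ) ^ k) ^ 2 := by
    rw [show (4 : ℝ) = 2 ^ 2 by norm_num, ← pow_mul, hqr, ← pow_mul, ← pow_mul]
    congr 1; rw [hn]; ring
  set R : ℝ := Real.exp cR with hR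
  have hR1 : 1 ≤ R := by rw [hR]; exact Real.one_le_exp hcR0
  have hQpos : (0 : ℝ) < (q : ℝ) ^ k := by positivity
  have hwR : ∀ j ≤ n, ∀ i, ‖w i ^ 2 ^ j‖ ≤ R := by
    intro j hj i
    have h2j : (2 : ℝ) ^ j ≤ (q : ℝ) ^ k := by
      have : 2 ^ j ≤ 2 ^ n := Nat.pow_le_pow_right (by norm_num) hj
      rw [h2n] at this; exact_mod_cast this
    rw [hw, hu, hv, hR, hcR]; exact norm_basePair_pow_le β hQpos h2j i
  set g := NormDescent.descend n A with hgdef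
  have hg0 : g ≠ 0 := NormDescent.descend_ne_zero hA0 n
  have hgdeg : g.totalDegree ≤ q ^ k * N := by
    calc g.totalDegree ≤ 2 ^ n * A.totalDegree := NormDescent.totalDegree_descend_le A n
      _ ≤ q ^ k * N := by rw [h2n]; exact Nat.mul_le_mul_left _ hAdeg
  have hglen : zlen g ≤ zlen A ^ 4 ^ n := NormDescent.zlen_descend_le A n
  have hgval : ‖MvPolynomial.aeval (fun i => w i ^ 2 ^ n) g‖ ≤
      ‖MvPolynomial.aeval w A‖ * (zlen A ^ 4 ^ n * R ^ (3 * 2 ^ n * A.totalDegree)) :=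
    NormDescent.norm_aeval_descend_le hA0 w hR1 n hwR
  -- the descended point is the FIXED pair `(e, e^β)`
  have hpt : (fun i => w i ^ 2 ^ n) = fun i => cexp (y i) := by
    funext i
    rcases Fin.exists_fin_two.mp ⟨i, rfl⟩ with h | h
    · rw [h]; simp only [hw, hy, Matrix.cons_val_zero]
      rw [hu, ← Complex.exp_nat_mul, h2n]; push_cast
      rw [mul_inv_cancel₀ (pow_ne_zero _ hqC)]
    · rw [h]; simp only [hw, hy, Matrix.cons_val_one, Matrix.cons_val_zero]
      rw [hv, ← Complex.exp_nat_mul, h2n]; push_cast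
      rw [mul_comm β, ← mul_assoc, mul_inv_cancel₀ (pow_ne_zero _ hqC), one_mul]
  -- Ably's lower bound
  set D' : ℕ := q ^ k * N with hD'
  set H : ℕ := ⌈zlen g⌉₊ with hH
  have hHc : ∀ mo, |g.coeff mo| ≤ (H : ℤ) := by
    intro mo
    have h1 : |((g.coeff mo : ℤ) : ℝ)| ≤ (H : ℝ) := (abs_coeff_le_zlen g mo).trans (Nat.le_ceil _)
    have h2 : ((|g.coeff mo| : ℤ) : ℝ) ≤ ((H : ℤ) : ℝ) := by push_cast; exact h1
    exact_mod_cast h2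
  have hlow := hmeas g D' H hg0 hgdeg hHc
  rw [← hpt] at hlow
  set Φ : ℝ := c₂ * (D' : ℝ) ^ 2 *
    (Real.log H + Real.exp (C * (D' : ℝ) ^ 2 * Real.log ((D' : ℝ) + 1))) with hΦ
  -- ### the bookkeeping, in powers of `B := q^{2k+1}`
  set B : ℝ := (q : ℝ) ^ (2 * k + 1) with hB
  have hB1 : 1 ≤ B := one_le_pow₀ hq1r
  have hB0 : 0 ≤ B := by linarith
  have hBe : B ^ 3 = (q : ℝ) ^ e := by rw [hB, he, ← pow_mul]; ring_nf
  have hB3 : B ≤ B ^ 3 := le_self_pow₀ hB1 (by norm_num)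
  have hB30 : 0 ≤ B ^ 3 := by positivity
  have hqB : (q : ℝ) ≤ B := by rw [hB]; exact le_self_pow₀ hq1r (by omega)
  have hqkB : (q : ℝ) ^ k * (q : ℝ) ^ k ≤ B := by
    rw [hB, ← pow_add]; exact pow_le_pow_right₀ hq1r (by omega)
  have hq2k1 : (q : ℝ) * ((q : ℝ) ^ k) ^ 2 = B := by rw [hB]; ring
  -- N, D'
  have hNr : (N : ℝ) ≤ cN * (q : ℝ) ^ k := by
    rw [hNdef, Nat.cast_mul, Nat.cast_pow, Nat.cast_add, hcN]
    have h1 : ((p : ℝ) + q) ^ k ≤ (cT * q) ^ k := pow_le_pow_left₀ (by positivity) hpq k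
    rw [mul_pow] at h1
    calc (d : ℝ) * ((p : ℝ) + q) ^ k ≤ d * (cT ^ k * (q : ℝ) ^ k) := mul_le_mul_of_nonneg_left h1 hd0
      _ = d * cT ^ k * (q : ℝ) ^ k := by ring
  have hN0 : (0 : ℝ) ≤ N := Nat.cast_nonneg N
  have hD'r : (D' : ℝ) ≤ cN * B := by
    rw [hD', Nat.cast_mul, Nat.cast_pow]
    calc (q : ℝ) ^ k * N ≤ (q : ℝ) ^ k * (cN * (q : ℝ) ^ k) := mul_le_mul_of_nonneg_left hNr (by positivity)
      _ = cN * ((q : ℝ) ^ k * (q : ℝ) ^ k) := by ring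
      _ ≤ cN * B := mul_le_mul_of_nonneg_left hqkB hcN0
  have hD'0 : (0 : ℝ) ≤ D' := Nat.cast_nonneg D'
  -- length of A
  have hZA : zlen A ≤ Real.exp (cA * q) := by
    have h1 : ((p : ℝ) + q) ^ d ≤ Real.exp (d * (cT * q)) :=
      (pow_le_pow_left₀ (by positivity) hpq d).trans (pow_le_exp_mul (by positivity) d)
    have h2 : L ≤ Real.exp (L * q) := (le_exp_self L).trans (Real.exp_le_exp.mpr (le_mul_of_one_le_right hL0 hq1r))
    calc zlen A ≤ ((p : ℝ) + q) ^ d * L := hAlen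
      _ ≤ Real.exp (d * (cT * q)) * Real.exp (L * q) := mul_le_mul h1 h2 hL0 (Real.exp_pos _).le
      _ = Real.exp (cA * q) := by rw [← Real.exp_add, hcA]; ring_nf
  have hZA0 : 0 ≤ zlen A := zlen_nonneg A
  have hZApow : zlen A ^ 4 ^ n ≤ Real.exp (cA * B) := by
    calc zlen A ^ 4 ^ n ≤ Real.exp (cA * q) ^ 4 ^ n := pow_le_pow_left₀ hZA0 hZA _
      _ = Real.exp ((4 ^ n : ℕ) * (cA * q)) := by rw [Real.exp_nat_mul]
      _ = Real.exp (cA * B) := by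
          congr 1; push_cast; rw [h4n, ← hq2k1]; ring
  -- log H
  have hg1 : 1 ≤ zlen g := NormDescent.one_le_zlen hg0
  have hH1 : (1 : ℝ) ≤ H := hg1.trans (Nat.le_ceil _)
  have hHle : (H : ℝ) ≤ 2 * Real.exp (cA * B) := by
    calc (H : ℝ) ≤ zlen g + 1 := (Nat.ceil_lt_add_one (zlen_nonneg g)).le
      _ ≤ Real.exp (cA * B) + Real.exp (cA * B) := by
          have := hglen.trans hZApow
          have h1 : (1 : ℝ) ≤ Real.exp (cA * B) := Real.one_le_exp (by positivity)
          linarith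
      _ = 2 * Real.exp (cA * B) := by ring
  have hlogH : Real.log H ≤ (cA + 1) * B := by
    calc Real.log H ≤ Real.log (2 * Real.exp (cA * B)) :=
          Real.log_le_log (by linarith) hHle
      _ = Real.log 2 + cA * B := by
          rw [Real.log_mul (by norm_num) (Real.exp_pos _).ne', Real.log_exp]
      _ ≤ 1 * B + cA * B := by
          have h2 : Real.log 2 ≤ B := (Real.log_two_lt_d9.le.trans (by norm_num)).trans hB1
          linarith only [h2]
      _ = (cA + 1) * B := by ring
  have hlogH0 : 0 ≤ Real.log H := Real.log_nonneg hH1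
  -- Φ ≤ exp(a q^e)
  have hΦle : Φ ≤ Real.exp (a * (q : ℝ) ^ e) := by
    have h := ably_exponent_le hC hc₂ hcN0 hcA0 hB1 hD'0 hD'r hlogH0 hlogH ha₁
    refine (le_of_eq hΦ).trans (h.trans (Real.exp_le_exp.mpr ?_))
    rw [← hBe, ha]
    have := mul_nonneg ha₂0 hB30
    linarith only [this]
  -- X ≤ exp(exp(a B³))
  set X : ℝ := (q : ℝ) ^ d * Kl * (zlen A ^ 4 ^ n * R ^ (3 * 2 ^ n * A.totalDegree)) with hX
  have hX0 : 0 ≤ X := by positivity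
  have hXle : X ≤ Real.exp (Real.exp (a * (q : ℝ) ^ e)) := by
    have hdegr : (A.totalDegree : ℝ) ≤ cN * (q : ℝ) ^ k := le_trans (by exact_mod_cast hAdeg) hNr
    have h2nr : (2 : ℝ) ^ n = (q : ℝ) ^ k := by rw [hn, hqr, ← pow_mul]
    have h := transport_factor_le hq0r hqB hB1 hKl0 hcA0 hcN0 hcR0 hZA0 hR hZApow h2nr hdegr hqkB ha₂
    refine (le_of_eq hX).trans (h.trans (Real.exp_le_exp.mpr ((le_exp_self _).trans
      (Real.exp_le_exp.mpr ?_))))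
    rw [← hBe, ha]
    have := mul_nonneg ha₁0 hB30
    linarith only [this]
  -- the upper bound of the descended value
  have hup : ‖MvPolynomial.aeval (fun i => w i ^ 2 ^ n) g‖ ≤ X * η := by
    calc ‖MvPolynomial.aeval (fun i => w i ^ 2 ^ n) g‖
        ≤ ‖MvPolynomial.aeval w A‖ * (zlen A ^ 4 ^ n * R ^ (3 * 2 ^ n * A.totalDegree)) := hgval
      _ ≤ ((q : ℝ) ^ d * Kl * η) * (zlen A ^ 4 ^ n * R ^ (3 * 2 ^ n * A.totalDegree)) :=
          mul_le_mul_of_nonneg_right hAle (by positivity)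
      _ = X * η := by rw [hX]; ring
  have hlow' : Real.exp (-Φ) ≤ ‖MvPolynomial.aeval (fun i => w i ^ 2 ^ n) g‖ := by
    simpa only [hΦ] using hlow
  exact endgame_lw hX0 hlow' hup hηlt hΦle hXle hq1r haq hme

end Summit.Schanuel.Schanuel.Theorems.RootDecomp1ELWTransport

end
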